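import Summits.Schanuel.Schanuel.Theorems.RootDecomp1KSectorTheorem09

/-!
# RootDecomp1KSectorTheorem — lens 1, generation 67, NODE 27 «THE SECTOR THEOREM BY ONE NEWTON STEP AT (∞,∞) — THE EDGE ENGINE» — FORK (B): the FIRST-ORDER SECTOR THEOREM at FLOOR F (`thinFibreAt_of_sectorCond : c k ≠ 0 → DomZero k c → SectorCond m₀ k c → ThinFibreAt m₀ (xPolyP k c)`, every m₀ / k / monomial support, the only escape the typed residue `Residue m₀ k c`; one PROVED Diophantine input `Ridout.padicRoth_int`; CLAIM L3031, PRICE L3032, ADDENDUM L3037, RULE K-R58, NODE L3047, VERDICT L3050) — continuation (RootDecomp1KSectorTheorem10): §12  `m₀ = 0` = LEVEL FINITENESS (writer's R-27-i); the non-dominant standing witness `W4P` is OUTSIDE — 13 declarations `residue_rho2` … `W4P_eq`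

(lens-1 g67 NODE 27 «THE SECTOR THEOREM BY ONE NEWTON STEP AT (∞,∞) — THE EDGE ENGINE» L3047: HOME kernel K = HOME/decomp-schanuel-lens-1/g67/lean/SectorTheorem.lean sha256 bbe43d14…, 2869 l, ONE namespace `Summit.Schanuel.Schanuel.Theorems.RootDecomp1KSectorTheorem`, imports the tree port …RootDecomp1KDigitPincer03 ONLY (node 26's record port; its closure holds every cell file used); no private / instance / set_option / notation / sorry / new axiom / binder / `decide` on levels; lens farm rc 0 · 0 errors · 0 sorries · warnings dupNamespace only, `--axioms` standard on the 18 deciding declarations, Probe rc 0 (g67/out/); memo g67/NODE-g67.md; CLAIM L3031 (ASK-FIRST under K-R57 (iii)); crit g12 PRICE L3032 (fork (A) ×0-AS-RECORD as posted / fork (B) a kernel meeting FLOOR F = «FIRST-ORDER SECTOR THEOREM» = THEOREM ×1 consuming K-R57 (iii); CHECKLIST K-g67 F1–F6 + S1–S8; RULE K-R58 PRE-ANNOUNCED) and PRICE ADDENDUM L3037 ((F6′) `W4P` by tree name; the ρ3 specimen `x² + x·Y² + Y⁵ + 3` of writer NOTE 17 L3036 = the F5 exhibit); census instruments LIVENESS-v36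 (key edge) / v37 (key ls2); crit g12 VERDICT L3050 (2026-09-02T03:35Z): THEOREM ×1 GRANTED under K-R57 (iii) for FORK (B) = the FIRST-ORDER SECTOR THEOREM AT FLOOR F (F1 F2 F3 (T) F4(α) F4(β) F5 F6 F6′ R-27-i and CHECKLIST S1–S8 met on the critic's own farm runs), the single ×1 of the sector line CONSUMED (K-R58 (i): no further ×1 on this line), TALLY lens-1 ×22 + THEOREM ×24, RULE K-R58 FIXED (PRICE L3032 (i)–(v) verbatim with the ADDENDUM L3037 gloss; W-27-2 = a ×0 wish for typed stratum predicates), PORT GO → census-1 (this port; PORT IDENTITY 27 owed by the seated critic). Port by census-1 gen 25 as `RootDecomp1KSectorTheorem01–10` (files ≤ 400 lines; `--supports stmt-Schanuel-33364`, the item stays OPEN; no census credit carried; RULE K-R58 (iv): UNCONDITIONAL PART ∪= these names): 01 = K l.1–307 of the prepped source (opens §1 / §2 / §3) — 20 decls `dMax`, `box`, `supp`, …, `two_zpow_inj`; 02 = K l.308–570 of the prepped source (opens §4) — 5 decls `far_pair`, `natDegree_le_dMax`, `norm_pow_sub_one_le`, …, `mem_supp`; 03 = K l.571–896 of the prepped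 source (opens §4b / §5) — 12 decls `layered_bound`, `edge_bound_one`, `edge_bound_crude`, …, `tendsto_partialSum_two`; 04 = K l.897–1221 of the prepped source (opens §6 / §7) — 10 decls `arch_finite`, `ridout_two`, `lt_rpow_neg_of_pow_mul_pow_lt`, …, `factorial_pred_le_div`; 05 = K l.1222–1500 of the prepped source (opens §8) — 4 decls `pair_levels_finite`, `dvd_lc_pow_val`, `den_le_of_dvd`, `den_rescaled_le`; 06 = K l.1501–1822 of the prepped source (opens §9) — 13 decls `size_regime`, `c_zero_ne_zero`, `far_levels_finite`, …, `sum_range_ite_shift`; 07 = K l.1823–2080 of the prepped source (inside §9) — 14 decls `layerPoly_lin2`, `layer0_lin2`, `layer1_lin2`, …, `natDegree_scaleShift`; 08 = K l.2081–2407 of the prepped source (opens §10) — 18 decls `thinFibreAt_xLinear_sector`, `thinFibreAt_xPolyP_one`, `edgeGood_of_gap`, …, `thinFibreAt_M_sector`; 09 = K l.2408–2633 of the prepped source (opens §11) — 17 decls `sectorCond_beta0_example`, `thinFibreAt_beta0_example`, `thinFibreAt_generic_xLinear_example`, …, `rho2_two`; 10 = K l.2634–2911 of the prepped source (opens §12)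 — 13 decls `residue_rho2`, `rho3`, `rho3_zero`, …, `W4P_eq`. 39 one-line docstrings synthesised for undocumented helper declarations (statements quoted, census port convention since gen 22); FOUR port-side `private` modifiers forced by the gate's dedup.landed lint on the first filing of part 08 (p848905): `thinFibreAt_xLinear` (≡ tree `RootDecomp1KXLinear.thinFibreAt_xLinear`, XLinear05 l.187 — K's proof kept as PRIVATE `thinFibreAt_xLinear_sector`, later uses resolve to the tree theorem via a selective open), `thinFibreAt_X6P_sector` (≡ `RootDecomp1KDigitPincer.thinFibreAt_X6P`), `xc_zero'` / `xc_three'` (≡ `RootDecomp1KDigitPincer.xc_zero` / `xc_three`), each with the reason in its docstring; everything else = K VERBATIM (statements, names, proofs, K's module docstring kept in part 01 below this provenance block).)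
-/

noncomputable section

namespace Summit.Schanuel.Schanuel.Theorems.RootDecomp1KSectorTheorem

open Polynomial LiouvilleNumber
open scoped Nat
open Summit.Schanuel.Schanuel.Theorems.RootDecomp1KTwoBaseCell (psNumer partialSum_eq_psNumer_div coprime_psNumer)
open Summit.Schanuel.Schanuel.Theorems.RootDecomp1KRelLiouvilleCell (partialSum_two_strictMono
  abs_liouvilleNumber_two_sub_partialSum)
open Summit.Schanuel.Schanuel.Theorems.RootDecomp1KDegreeLadder
open Summit.Schanuel.Schanuel.Theorems.RootDecomp1KXLinear (xLinP bev_xLinP norm_ratCast_two norm_ratCast_of_le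
  norm_psNumer_sub_one)
open Summit.Schanuel.Schanuel.Theorems.RootDecomp1KDigitPincer (xc XP X6P)
open Summit.Schanuel.Schanuel.Theorems.RootDecomp1KOddEmpty (W4P w4C vG natDegree_vG)
open Summit.Schanuel.Schanuel.Theorems.RootDecomp1KHyperellipticSiegel (mQ mC mC_zero mC_one mC_two natDegree_mQ
  coeff_mQ_five leadingCoeff_mQ)
open Summit.Schanuel.Schanuel.Theorems.RootDecomp1KXLinearII (norm_aeval_le norm_psNumer)
open Summit.Schanuel.Schanuel.Theorems.RootDecomp1KXTop
open Summit.Schanuel.Schanuel.Theorems.RootDecomp1KXAll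
open Summit.Schanuel.Schanuel.Theorems.RootDecomp1KLevelFinite
open Summit.Schanuel.Schanuel.Theorems.RootDecomp1KLocalExponent
open Summit.Schanuel.Schanuel.Theorems.RootDecomp1KIntegrality
open Summit.Schanuel.Schanuel.Theorems.RootDecomp1KXLinear (thinFibreAt_xLinear)  -- port: the tree theorem whose statement K's F4 (α) repeats (dedup.landed p848905)

/-- **STRATUM ρ2 (MULTIPLE) IS IN THE RESIDUE: `(Y² − 17x)² − x·Y` at `m₀ ≤ 2`.**  The violating hull pair
`(c₀, c₁)` has slope `1/2`, top weight `4`, edge polynomial `f = W⁴ − 34W² + 289 = (W² − 17)²`; the root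
`β = √17 ∈ ℚ₂` (Hensel) has MULTIPLICITY `μ = 2`: (I) fails; (C) needs `μ·s = 2 < q = 2`: false — the DIGIT
CEILING, not a monomial; (R) needs `f'(β) ≠ 0`: false. -/
theorem residue_rho2 {m₀ : ℕ} (hm : m₀ ≤ 2) : Residue m₀ 2 rho2 := by
  classical
  have hd0 : (rho2 0).natDegree = 4 := by rw [rho2_zero, natDegree_X_pow]
  have hd1 : (rho2 1).natDegree = 2 := by rw [rho2_one]; compute_degree!
  have hd2 : (rho2 2).natDegree = 0 := by rw [rho2_two, natDegree_C]
  have h00 : rho2 0 ≠ 0 := by rw [rho2_zero]; exact pow_ne_zero _ X_ne_zero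
  have h11 : rho2 1 ≠ 0 := by
    intro h
    rw [h, natDegree_zero] at hd1
    omega
  intro hS
  have hgood : EdgeGood 2 rho2 1 2 := by
    have := hS 0 1 (by norm_num) (by norm_num) h00 h11 (by rw [hd0, hd1]; norm_num) (by rw [hd0, hd1]; omega)
      (by
        intro j hj _
        rw [hd0, hd1]
        interval_cases j
        · rw [hd0]
        · rw [hd1]
        · rw [hd2])
    rwa [hd0, hd1] at this
  obtain ⟨M, hT, hroots⟩ := hgood
  have hS' : ∀ p ∈ ({(0, 4), (1, 2), (1, 1), (2, 0)} : Finset (ℕ × ℕ)), p.1 ≤ 2 := by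
    intro p hp
    simp only [Finset.mem_insert, Finset.mem_singleton] at hp
    rcases hp with rfl | rfl | rfl | rfl <;> norm_num
  have hsupp : ∀ p : ℕ × ℕ, p.1 ≤ 2 → (rho2 p.1).coeff p.2 ≠ 0 →
      p ∈ ({(0, 4), (1, 2), (1, 1), (2, 0)} : Finset (ℕ × ℕ)) := by
    rintro ⟨j, i⟩ hj hc
    dsimp only at hj hc
    simp only [Finset.mem_insert, Finset.mem_singleton, Prod.mk.injEq]
    interval_cases j
    · rw [rho2_zero, coeff_X_pow] at hc
      split_ifs at hc with h4
      · exact Or.inl ⟨rfl, h4⟩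
      · exact (hc rfl).elim
    · rw [rho2_one, coeff_sub, coeff_C_mul, coeff_X_pow, coeff_X] at hc
      split_ifs at hc with h2 h1 h1
      · omega
      · exact Or.inr (Or.inl ⟨rfl, h2⟩)
      · exact Or.inr (Or.inr (Or.inl ⟨rfl, h1.symm⟩))
      · exact (hc (by ring)).elim
    · rw [rho2_two, coeff_C] at hc
      split_ifs at hc with h0
      · exact Or.inr (Or.inr (Or.inr ⟨rfl, h0⟩))
      · exact (hc rfl).elim
  have h4 : 4 ≤ M := by
    have := hT.1 (0, 4) (mem_supp_of (by norm_num) (by rw [rho2_zero, coeff_X_pow, if_pos rfl]; norm_num))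
    omega
  have hM : M = 4 := by
    by_contra hne
    apply hT.2
    rw [layerPoly_eq_sum 2 rho2 _ hS' hsupp, Finset.sum_eq_zero]
    intro p hp
    exfalso
    rw [Finset.mem_filter] at hp
    obtain ⟨hp1, hp2⟩ := hp
    simp only [Finset.mem_insert, Finset.mem_singleton] at hp1
    rcases hp1 with rfl | rfl | rfl | rfl <;> norm_num at hp2 <;> omega
  subst hM
  have hf0 : layerPoly 2 rho2 1 2 4 0 = X ^ 4 + C (-34) * X ^ 2 + C 289 := by
    rw [layerPoly_eq_sum 2 rho2 _ hS' hsupp, Finset.sum_filter, Finset.sum_insert (by decide),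
      Finset.sum_insert (by decide), Finset.sum_insert (by decide), Finset.sum_singleton]
    have h04 : (rho2 0).coeff 4 = 1 := by rw [rho2_zero, coeff_X_pow, if_pos rfl]
    have h12 : (rho2 1).coeff 2 = -34 := by
      rw [rho2_one, coeff_sub, coeff_C_mul, coeff_X_pow, if_pos rfl, coeff_X, if_neg (by norm_num)]; ring
    have h20 : (rho2 2).coeff 0 = 289 := by rw [rho2_two, coeff_C, if_pos rfl]
    norm_num [h04, h12, h20]
    ring
  -- the root `β = √17 ∈ ℚ₂`, of multiplicity two
  obtain ⟨y, hy⟩ := exists_sqrt_seventeen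
  have hβ2 : (algebraMap ℚ_[2] (PadicAlgCl 2) y) ^ 2 = 17 := by rw [← map_pow, hy, map_ofNat]
  have hβ0 : algebraMap ℚ_[2] (PadicAlgCl 2) y ≠ 0 := by
    intro h
    rw [h, zero_pow two_ne_zero] at hβ2
    norm_num at hβ2
  have hβ4 : (algebraMap ℚ_[2] (PadicAlgCl 2) y) ^ 4 = 289 := by
    rw [show (4 : ℕ) = 2 * 2 by norm_num, pow_mul, hβ2]; norm_num
  have hroot : aeval (algebraMap ℚ_[2] (PadicAlgCl 2) y) (layerPoly 2 rho2 1 2 4 0) = 0 := by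
    rw [hf0, map_add, map_add, map_mul, map_pow, map_pow, aeval_X, aeval_C, aeval_C, eq_intCast, eq_intCast,
      hβ4, hβ2]
    norm_num
  rcases hroots _ hβ0 hroot with hirr | ⟨L, -, -, hμq⟩ | ⟨hder, -⟩
  · exact hirr y rfl
  · -- (C): the multiplicity is `2`, and `2·1 < 2` is false
    have hμ : 2 ≤ rootMult (layerPoly 2 rho2 1 2 4 0) (algebraMap ℚ_[2] (PadicAlgCl 2) y) := by
      unfold rootMult
      rw [le_rootMultiplicity_iff ((Polynomial.map_ne_zero_iff (RingHom.injective_int _)).mpr hT.2)]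
      refine ⟨(X + C (algebraMap ℚ_[2] (PadicAlgCl 2) y)) ^ 2, ?_⟩
      have hmap : (layerPoly 2 rho2 1 2 4 0).map (algebraMap ℤ (PadicAlgCl 2)) =
          ((X : (PadicAlgCl 2)[X]) ^ 2 - C (17 : PadicAlgCl 2)) ^ 2 := by
        rw [hf0, Polynomial.map_add, Polynomial.map_add, Polynomial.map_mul, Polynomial.map_pow,
          Polynomial.map_pow, map_X, map_C, map_C, eq_intCast, eq_intCast]
        have h1 : ((-34 : ℤ) : PadicAlgCl 2) = -(17 + 17) := by norm_num
        have h2 : ((289 : ℤ) : PadicAlgCl 2) = 17 * 17 := by norm_num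
        rw [h1, h2, map_neg, map_add, map_mul]
        ring
      have hC2 : (C (algebraMap ℚ_[2] (PadicAlgCl 2) y)) ^ 2 = C (17 : PadicAlgCl 2) := by
        rw [← map_pow, hβ2]
      have e : ((X : (PadicAlgCl 2)[X]) - C (algebraMap ℚ_[2] (PadicAlgCl 2) y)) ^ 2 *
          (X + C (algebraMap ℚ_[2] (PadicAlgCl 2) y)) ^ 2 =
          (X ^ 2 - (C (algebraMap ℚ_[2] (PadicAlgCl 2) y)) ^ 2) ^ 2 := by
        ring
      rw [hmap, e, hC2]
    omega
  · -- (R): `f'(β) = 4β³ − 68β = 4β(β² − 17) = 0`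
    apply hder
    have hd : derivative (X ^ 4 + C (-34) * X ^ 2 + C 289 : ℤ[X]) = C 4 * X ^ 3 + C (-68) * X := by
      rw [derivative_add, derivative_add, derivative_X_pow, derivative_C_mul_X_pow, derivative_C, add_zero]
      norm_num
    rw [hf0, hd, map_add, map_mul, map_mul, map_pow, aeval_X, aeval_C, aeval_C, eq_intCast, eq_intCast]
    push_cast
    linear_combination (4 * algebraMap ℚ_[2] (PadicAlgCl 2) y) * hβ2

/-- the coefficient vector of the stratum-ρ3 SPECIMEN `x² + x·Y² + Y⁵ + 3` (writer NOTE 17 L3036, PRICE ADDENDUM L3037 (2)):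
`c₀ = Y⁵ + 3`, `c₁ = Y²`, `c₂ = 1` — one monomial away from `M 67`. -/
def rho3 (j : ℕ) : ℤ[X] := if j = 0 then X ^ 5 + C 3 else if j = 1 then X ^ 2 else if j = 2 then 1 else 0

/-- `: rho3 0 = X ^ 5 + C 3`. -/
theorem rho3_zero : rho3 0 = X ^ 5 + C 3 := by simp [rho3]

/-- `: rho3 1 = X ^ 2`. -/
theorem rho3_one : rho3 1 = X ^ 2 := by simp [rho3]

/-- `: rho3 2 = 1`. -/
theorem rho3_two : rho3 2 = 1 := by simp [rho3]

/-- **STRATUM ρ3 (PEELABLE-DEEP) IS IN THE RESIDUE: `x² + x·Y² + Y⁵ + 3` at `m₀ ≤ 2`.**  The violating hull pair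
`(c₀, c₂)` has slope `2/5`, top weight `10`, edge polynomial `f = W⁵ + 1` with the simple RATIONAL root `β = −1`,
and `f_1 = W²` (the monomial `x·Y²`, weight `9`) with `f_1(−1) = 1 ≠ 0`: `G_eff = 1 ≤ s = 2`.  (I) fails; (C) needs
`L > 2` hence `f_1 = 0`: false; (R) needs `L > 2` hence `f_1(β) = 0`: false.  Its branch
`Y = −x^{2/5} − x^{1/5}/5 + O(1)` carries an `x`-DEPENDENT RATIONAL correction — a SECOND Newton step (programme (a))
would decide it: toolkit homework, not a witness (RULE K-R58 (ii)). -/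
theorem residue_rho3 {m₀ : ℕ} (hm : m₀ ≤ 2) : Residue m₀ 2 rho3 := by
  classical
  have hd0 : (rho3 0).natDegree = 5 := by rw [rho3_zero]; exact natDegree_X_pow_add_C
  have hd1 : (rho3 1).natDegree = 2 := by rw [rho3_one, natDegree_X_pow]
  have hd2 : (rho3 2).natDegree = 0 := by rw [rho3_two, natDegree_one]
  have h00 : rho3 0 ≠ 0 := by rw [rho3_zero]; exact X_pow_add_C_ne_zero (by norm_num) 3
  have h22 : rho3 2 ≠ 0 := by rw [rho3_two]; exact one_ne_zero
  intro hS
  have hgood : EdgeGood 2 rho3 2 5 := by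
    have := hS 0 2 (by norm_num) le_rfl h00 h22 (by rw [hd0, hd2]; norm_num) (by rw [hd0, hd2]; omega)
      (by
        intro j hj _
        rw [hd0, hd2]
        interval_cases j
        · rw [hd0]
        · rw [hd1]; norm_num
        · rw [hd2])
    rwa [hd0, hd2] at this
  obtain ⟨M, hT, hroots⟩ := hgood
  have hS' : ∀ p ∈ ({(0, 5), (0, 0), (1, 2), (2, 0)} : Finset (ℕ × ℕ)), p.1 ≤ 2 := by
    intro p hp
    simp only [Finset.mem_insert, Finset.mem_singleton] at hp
    rcases hp with rfl | rfl | rfl | rfl <;> norm_num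
  have hsupp : ∀ p : ℕ × ℕ, p.1 ≤ 2 → (rho3 p.1).coeff p.2 ≠ 0 →
      p ∈ ({(0, 5), (0, 0), (1, 2), (2, 0)} : Finset (ℕ × ℕ)) := by
    rintro ⟨j, i⟩ hj hc
    dsimp only at hj hc
    simp only [Finset.mem_insert, Finset.mem_singleton, Prod.mk.injEq]
    interval_cases j
    · rw [rho3_zero, coeff_add, coeff_X_pow, coeff_C] at hc
      split_ifs at hc with h5 h0 h0
      · omega
      · exact Or.inl ⟨rfl, h5⟩
      · exact Or.inr (Or.inl ⟨rfl, h0⟩)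
      · exact (hc (by ring)).elim
    · rw [rho3_one, coeff_X_pow] at hc
      split_ifs at hc with h2
      · exact Or.inr (Or.inr (Or.inl ⟨rfl, h2⟩))
      · exact (hc rfl).elim
    · rw [rho3_two, coeff_one] at hc
      split_ifs at hc with h0
      · exact Or.inr (Or.inr (Or.inr ⟨rfl, h0⟩))
      · exact (hc rfl).elim
  have h10 : 10 ≤ M := by
    have := hT.1 (0, 5) (mem_supp_of (by norm_num)
      (by rw [rho3_zero, coeff_add, coeff_X_pow, if_pos rfl, coeff_C, if_neg (by norm_num)]; norm_num))
    omega
  have hM : M = 10 := by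
    by_contra hne
    apply hT.2
    rw [layerPoly_eq_sum 2 rho3 _ hS' hsupp, Finset.sum_eq_zero]
    intro p hp
    exfalso
    rw [Finset.mem_filter] at hp
    obtain ⟨hp1, hp2⟩ := hp
    simp only [Finset.mem_insert, Finset.mem_singleton] at hp1
    rcases hp1 with rfl | rfl | rfl | rfl <;> norm_num at hp2 <;> omega
  subst hM
  have hf0 : layerPoly 2 rho3 2 5 10 0 = X ^ 5 + 1 := by
    rw [layerPoly_eq_sum 2 rho3 _ hS' hsupp, Finset.sum_filter, Finset.sum_insert (by decide),
      Finset.sum_insert (by decide), Finset.sum_insert (by decide), Finset.sum_singleton]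
    have h05 : (rho3 0).coeff 5 = 1 := by
      rw [rho3_zero, coeff_add, coeff_X_pow, if_pos rfl, coeff_C, if_neg (by norm_num), add_zero]
    have h20 : (rho3 2).coeff 0 = 1 := by rw [rho3_two, coeff_one, if_pos rfl]
    norm_num [h05, h20]
  have hf1 : layerPoly 2 rho3 2 5 10 1 = X ^ 2 := by
    rw [layerPoly_eq_sum 2 rho3 _ hS' hsupp, Finset.sum_filter, Finset.sum_insert (by decide),
      Finset.sum_insert (by decide), Finset.sum_insert (by decide), Finset.sum_singleton]
    have h12 : (rho3 1).coeff 2 = 1 := by rw [rho3_one, coeff_X_pow, if_pos rfl]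
    norm_num [h12]
  -- the rational root `β = −1`
  have hβ0 : algebraMap ℚ_[2] (PadicAlgCl 2) (-1) ≠ 0 := by
    rw [map_neg, map_one]; exact neg_ne_zero.mpr one_ne_zero
  have hroot : aeval (algebraMap ℚ_[2] (PadicAlgCl 2) (-1)) (layerPoly 2 rho3 2 5 10 0) = 0 := by
    rw [hf0, map_neg, map_one, map_add, map_pow, aeval_X, map_one]
    norm_num
  rcases hroots _ hβ0 hroot with hirr | ⟨L, hlay, hμL, -⟩ | ⟨-, L, hlay, hsL, -⟩
  · exact hirr (-1) rfl
  · have hμ : 1 ≤ rootMult (layerPoly 2 rho3 2 5 10 0) (algebraMap ℚ_[2] (PadicAlgCl 2) (-1)) := by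
      unfold rootMult
      refine (rootMultiplicity_pos ?_).mpr ?_
      · exact (Polynomial.map_ne_zero_iff (RingHom.injective_int _)).mpr hT.2
      · rw [IsRoot.def, ← aeval_eq_eval_map]
        exact hroot
    have := hlay 1 le_rfl (by omega)
    rw [hf1] at this
    exact pow_ne_zero 2 X_ne_zero this
  · have := hlay 1 le_rfl (by omega)
    rw [hf1, map_pow, aeval_X, map_neg, map_one] at this
    norm_num at this

/-! ## §12  `m₀ = 0` = LEVEL FINITENESS (writer's R-27-i); the non-dominant standing witness `W4P` is OUTSIDE -/

/-- `ThinFibreAt 0 P → LevelFinite P` (the clause at quality `0` with `C ≥ 1` is never satisfied, so beyond `N₀`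
there is NO non-degenerate level point of height `≤ C`). -/
theorem levelFinite_of_thinFibreAt_zero {P : ℤ[X][X]} (h : ThinFibreAt 0 P) : LevelFinite P := by
  intro C
  obtain ⟨N₀, hN₀⟩ := h (max C 1)
  refine (Set.finite_lt_nat N₀).subset ?_
  rintro N ⟨r, hrC, hP, hx⟩
  rw [Set.mem_setOf_eq]
  by_contra hN
  have := hN₀ N (not_lt.mp hN) r (hrC.trans (le_max_left _ _)) hP hx
  rw [zero_mul, pow_zero] at this
  have h1 : (1 : ℝ) ≤ max C 1 * 2 ^ (N + 1)! := by
    calc (1 : ℝ) = 1 * 1 := by ring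
      _ ≤ max C 1 * 2 ^ (N + 1)! :=
        mul_le_mul (le_max_right _ _) (one_le_pow₀ (by norm_num)) zero_le_one
          (zero_le_one.trans (le_max_right _ _))
  linarith

/-- **the engine at quality `0` is LEVEL FINITENESS**: `SectorCond 0` (EVERY hull slope good) gives
`LevelFinite (xPolyP k c)` on the dominant sector. -/
theorem levelFinite_of_sectorCond_zero (k : ℕ) (c : ℕ → ℤ[X]) (hB : c k ≠ 0) (hdom : DomZero k c)
    (hS : SectorCond 0 k c) : LevelFinite (xPolyP k c) :=
  levelFinite_of_thinFibreAt_zero (thinFibreAt_of_sectorCond k c hB hdom hS)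

/-- **LEVEL FINITENESS of every dominant `x`-linear member** `A(Y) + x·B(Y)`, `B ≠ 0`, `deg B + 2 ≤ deg A`. -/
theorem levelFinite_xLinear (A B : ℤ[X]) (hB : B ≠ 0) (hdeg : B.natDegree + 2 ≤ A.natDegree) :
    LevelFinite (xLinP A B) :=
  levelFinite_of_thinFibreAt_zero (thinFibreAt_xLinear A B hB hdeg 0)

/-- level finiteness of node 26's whole pencil and node 23's whole family, by the engine at quality `0`. -/
theorem levelFinite_XP_sector (b c : ℤ) : LevelFinite (XP b c) :=
  levelFinite_of_thinFibreAt_zero (thinFibreAt_XP_sector b c 0)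

/-- `(j : ℤ) : LevelFinite (xPolyP 2 (mC j))`. -/
theorem levelFinite_M_sector (j : ℤ) : LevelFinite (xPolyP 2 (mC j)) :=
  levelFinite_of_thinFibreAt_zero (thinFibreAt_M_sector j 0)

/-- **(F6′) the standing witness of record `W4P = (Y⁴ − 17)·x² + (Y³ + 1)·x + (Y + 2) = xPolyP 2 w4C` (tree
`RootDecomp1KOddEmpty.W4P`) is NOT DOMINANT (`deg c₁ = 3 > 1 = deg c₀`): OUTSIDE the sector of this file.** -/
theorem not_domZero_w4C : ¬ DomZero 2 w4C := by
  intro h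
  have := h 1 le_rfl (by norm_num)
  rw [show w4C 1 = vG by simp [w4C], show w4C 0 = X + C 2 by simp [w4C], natDegree_vG, natDegree_X_add_C] at this
  omega

/-- `: W4P = xPolyP 2 w4C`. -/
theorem W4P_eq : W4P = xPolyP 2 w4C := rfl

end Summit.Schanuel.Schanuel.Theorems.RootDecomp1KSectorTheorem
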